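import Summits.QuantumFields.YangMills.Theorems.AlphaInputsT3ACv3RegionalThm1CarrierData
import HarnessLib

/-!
# `AlphaInputsT3ACv3RegionalThm1LevelMin` — THE AT-SIGHT HALF OF THE NESTED-MINIMISER TRANSPORT FOR THE `ℰp` TOWER: (T) a shorter history has the SAME
# regions∕admissibility below its top, (E) `RegOnT3` is monotone in the level AND indifferent to the carrier's `η`, (hreg) a member of the level-`k` regular fibre
# lies in the level-`n` regular fibre OF ITS OWN `n`-DATUM (`n ≤ k`, larger radius), (N) [Balaban1985Variational] Thm 1 at the regional carrier ⇒ LQB's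
# `B10NestedMinimizer.LevelMin` package ON NORMALISED DATA, (hcrit) minimal ⇒ critical (reading R2)

Cell `ym3-torus` (rung R3 — finite-torus SU(2) YM₃, NOT the Clay problem), seat `ym-ust-19936-w6` (gen 4), WIDTH helper on stmt-QuantumFields-19936 `HistoryTailL`;
LEAD ★w1-19936 g4 row L-R6 «NESTED-MINIMISER TRANSPORT for the `ℰp` tower» — this file is §2∕§3 (T)(E)(N) of the seat's LOCATE memo
`ym-ust-19936-w6/g4/LOCATE-NESTED-MINIMISER-TRANSPORT-w6g4.md` (19936 evidence #48): exactly the hypotheses of LQB's ✓`B10Eq68TorusRegularity.regAt_of_crit_nested`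
that instantiate by bookkeeping over the regional carrier ✓`AlphaInputsT3ACv3RegionalThm1Carrier` (`varProblemRegT3`) and its datum map ✓`…CarrierData` (`datumE`∕`ofDataE`).
`--supports stmt-QuantumFields-19936 --as helper`; count-neutral; def-free.

WHAT (all for the T³ record letters `F 𝔠 γ hγ hγ1 K`; `Ω(h) := Carriers.Omega … k h`, `Λ(h) := lam42 Ω(h) k`, `av := fun i => blockAvg ℰp`):
* (T) `RegionalVP.Omega_eq_of_castLE`∕`admissible_of_castLE` — for `n ≤ k` and a history `h′ : Hist P n` that IS the first `n` passages of `h : Hist P k`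
  (`∀ j, h′ j = h (Fin.castLE _ j)`; no truncation DEFINITION is introduced): `Ω_j(h′) = Ω_j(h)` for `j ≤ n`, and `h′` is admissible if `h` is (✓`Omega_succ_of_le`,
  ✓`Hist.Admissible.proj` iterated).
* (E) `RegionalVP.inSpace_mono_levels_eta` — LQB's full space `InSpace k Ω ε η` (both clauses of [Balaban1985Variational] (2)) is monotone in the level (`k′ ≤ k`: fewer
  clauses), in the radius, depends on the regions only below `k′`, and is INDIFFERENT to `η > 0` (the divergence clause is `η`-free after normalisation,
  ✓`regDivAt_iff_unit`); hence `AlphaInputsT3AC.regOnT3_of_castLE : RegOnT3 k h e U → RegOnT3 n h′ e′ U` (`n ≤ k`, `e ≤ e′`) although the two carriers carry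
  `η = L^{−k}` resp. `L^{−n}`.
* (hreg) `AlphaInputsT3AC.mem_regFibreRegT3_datumE_of_castLE` — `U ∈ regFibreRegT3 k h e 𝓥 → U ∈ regFibreRegT3 n h′ e′ (datumE av n Λ(h′) U)`: the level-`n` regular fibre
  (6)∕(8) OF `U`'s OWN `n`-DATUM (✓`constraintOn_datumE_self`) — the `hreg` of the transport, with NO scale-change constant (fewer clauses, larger radius).
* (N) ★`AlphaInputsT3AC.levelMin_of_thm1At_regT3` — `B11Thm1.Thm1At C (varProblemRegT3 k h).toVarProblem` ⇒ for `0 < ε₁ ≤ a₁` a minimiser MAP `Uk` with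
  `LevelMin wilsonAction4 (datumE av k Λ(h)) (fun _ => {U | RegOnT3 k h (B₃ε₁) U}) {y | ofDataE k Λ(h) y = y ∧ Reg7On av k Ω(h) Λ(h) ε₁ y} Uk`, the R1 clause
  `OnMinimalOrbit (B₃ε₁) y (Uk y)` and the R2 uniqueness clause passed through — LQB's ✓`levelMin_of_thm1At` CANNOT be applied as is (its `B11Dict.inB_iff : InB V U ↔ kd U = V`
  is false for un-normalised multi-level data: `ConstraintOn` reads `V` on `bondsOn j Λ_j` only), so the admissible data are CUT to normal forms, where
  ✓`constraintOn_iff_datumE_eq` is the dictionary.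
* (hcrit) `AlphaInputsT3AC.isCritical_of_onMinimalOrbit` — reading R1 ⇒ reading R2 at the same radius (`0 < e`).

HONEST FRAMING.  Bookkeeping only (inductions on the history length, monotonicity, one use of the axiom of choice); nothing of [Balaban1985Variational] is asserted
(`Thm1At` is a HYPOTHESIS of (N)); the NOT-bookkeeping hypotheses of the transport (`hlaw`∕`huniq` = the criticality currency, `hadm` = the admissibility induction; memo
#48 §4) are NOT touched; B1, NODE O d = 3, the stub `stub_laneRecordsV4Chi` and the crux are NOT claimed; YM₃ on T³ = rung R3 — not d = 4, no mass gap, not Clay.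
References: T. Bałaban, CMP 102 (1985) 277–309 [Balaban1985Variational] ((2)–(8) pp.278–279, Thm 1 p.279); CMP 102 (1985) 255–275 [Balaban1985UV3] ((38)–(42) p.266,
(68) p.273); CMP 99 (1985) 75–102 [Balaban1985RegularSpaces] ((1.7)–(1.9) p.77).
-/

set_option autoImplicit false

noncomputable section

/-! ## §1 (T) A shorter history has the same regions and admissibility below its top -/

namespace Summit.QuantumFields.YangMills.Theorems.RegionalVP

open Set
open scoped Matrix.Norms.L2Operator
open Literature.MathematicalPhysics.QuantumFieldTheory.Balaban1983to89
open Literature.MathematicalPhysics.QuantumFieldTheory.Balaban1983to89.B10Eq68TorusRegularity (InSpace InSpaceA RegDivAt regDivAt_iff_unit)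
open Summit.QuantumFields.Balaban3D.Carriers

variable {P : Params}

/-- **(T) REGIONS ARE INHERITED**: if `h′ : Hist P n` consists of the first `n ≤ k` passages of `h : Hist P k`, then `Ω_j(h′) = Ω_j(h)` for every `j ≤ n`
(the collar rule (38)–(39) builds `Ω_{j}` from the passages `< j` only; ✓`Omega_succ_of_le` iterated). [cite: Balaban1985UV3, (38)–(39) p.266] -/
theorem Omega_eq_of_castLE (M₁ : ℕ) (Rcol : ℕ → ℕ) :
    ∀ {k : ℕ} (h : Hist P k) {n : ℕ} (hn : n ≤ k) (h' : Hist P n), (∀ j : Fin n, h' j = h (Fin.castLE hn j)) →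
      ∀ j : ℕ, j ≤ n → Omega M₁ Rcol n h' j = Omega M₁ Rcol k h j
  | 0, h, n, hn, h', hh', j, hj => by
    obtain rfl : n = 0 := Nat.le_zero.mp hn
    rw [Subsingleton.elim h' h]
  | k + 1, h, n, hn, h', hh', j, hj => by
    rcases Nat.lt_or_eq_of_le hn with hlt | rfl
    · have hnk : n ≤ k := Nat.lt_succ_iff.mp hlt
      rw [Omega_succ_of_le M₁ Rcol h (hj.trans hnk)]
      refine Omega_eq_of_castLE M₁ Rcol h.proj hnk h' (fun i => ?_) j hj
      rw [hh' i]
      rfl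
    · have hh : h' = h := funext fun i => (hh' i).trans rfl
      rw [hh]

/-- **(T) ADMISSIBILITY IS INHERITED** by the shorter history (✓`Hist.Admissible.proj` iterated). [cite: Balaban1985UV3, pp.267–268] -/
theorem admissible_of_castLE (M₁ : ℕ) (Rcol : ℕ → ℕ) :
    ∀ {k : ℕ} (h : Hist P k) {n : ℕ} (hn : n ≤ k) (h' : Hist P n), (∀ j : Fin n, h' j = h (Fin.castLE hn j)) →
      Hist.Admissible M₁ Rcol k h → Hist.Admissible M₁ Rcol n h'
  | 0, h, n, hn, h', hh', hadm => by
    obtain rfl : n = 0 := Nat.le_zero.mp hn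
    rwa [Subsingleton.elim h' h]
  | k + 1, h, n, hn, h', hh', hadm => by
    rcases Nat.lt_or_eq_of_le hn with hlt | rfl
    · have hnk : n ≤ k := Nat.lt_succ_iff.mp hlt
      refine admissible_of_castLE M₁ Rcol h.proj hnk h' (fun i => ?_) hadm.proj
      rw [hh' i]
      rfl
    · have hh : h' = h := funext fun i => (hh' i).trans rfl
      rwa [hh]

/-! ## §2 (E) LQB's full space (2) is monotone in the level and the radius and indifferent to `η` -/

/-- **(E) FEWER CLAUSES, LARGER RADIUS, ANY `η`**: `InSpace k Ω ε η U → InSpace k′ Ω′ ε′ η′ U` for `k′ ≤ k`, `ε ≤ ε′`, `0 < η, η′` and regions agreeing below `k′`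
(the plaquette clause is `η`-free; the divergence clause is `η`-free after normalisation, ✓`regDivAt_iff_unit`). [cite: Balaban1985Variational, (2) p.278; Balaban1985RegularSpaces, (1.7)–(1.9) p.77] -/
theorem inSpace_mono_levels_eta {N : ℕ} {k k' : ℕ} (hk : k' ≤ k) {Ω Ω' : ℕ → Set (Site P 0)} (hΩ : ∀ j, j ≤ k' → Ω' j = Ω j)
    {ε ε' η η' : ℝ} (hε : ε ≤ ε') (hη : 0 < η) (hη' : 0 < η') (U : GaugeField P 0 (Matrix.unitaryGroup (Fin N) ℂ))
    (h : InSpace k Ω ε η U) : InSpace k' Ω' ε' η' U := by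
  intro j hj
  obtain ⟨h1, h2⟩ := h j (hj.trans hk)
  rw [hΩ j hj]
  refine ⟨h1.mono_eps hε, (regDivAt_iff_unit hη' _).mpr fun b hb => ?_⟩
  have h3 := (regDivAt_iff_unit hη _).mp h2 b hb
  have hL : (0 : ℝ) ≤ (((P.L : ℝ) ^ j)⁻¹) ^ 3 := by have := P.L_pos; positivity
  exact h3.trans_le (mul_le_mul_of_nonneg_right hε hL)

end Summit.QuantumFields.YangMills.Theorems.RegionalVP

/-! ## §3 The T³ instance: `RegOnT3`∕`regFibreRegT3` across levels of one history; (N) `LevelMin` from `Thm1At`; (hcrit) -/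

namespace Summit.QuantumFields.YangMills.Theorems

open MeasureTheory Set
open scoped Matrix.Norms.L2Operator
open Literature.MathematicalPhysics.QuantumFieldTheory.Balaban1983to89
open Literature.MathematicalPhysics.QuantumFieldTheory.Balaban1983to89.T3ContinuumYM3Torus
open Literature.MathematicalPhysics.QuantumFieldTheory.Balaban1983to89.T3UnitLawDensityEML (ℰp)
open Literature.MathematicalPhysics.QuantumFieldTheory.Balaban1983to89.B10Eq68TorusRegularity (InSpace)
open Literature.MathematicalPhysics.QuantumFieldTheory.Balaban1983to89.B10Eq42TorusConstraint (lam42)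
open Literature.MathematicalPhysics.QuantumFieldTheory.Balaban1983to89.B10NestedMinimizer (LevelMin)
open Literature.MathematicalPhysics.QuantumFieldTheory.Balaban1985CMP102.Setting
open Summit.QuantumFields.Balaban3D.Carriers
open Summit.QuantumFields.Balaban3D.Proofs.Primitives (AlphaConsts)
open Summit.QuantumFields.YangMills.Theorems.RegionalVP

section T3

variable {F : T3Family} {𝔠 : AlphaConsts F.L (suGroupModel 2).N} {γ : ℝ} {hγ : 0 < γ} {hγ1 : γ ≤ (min 𝔠.gamma0 1) ^ 2} {K : ℕ}

/-- **(E) AT THE CARRIER: `RegOnT3 k h e U → RegOnT3 n h′ e′ U`** for `n ≤ k`, `e ≤ e′` and `h′` the first `n` passages of `h` — although `varProblemRegT3 k h` carries `η = L^{−k}`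
and `varProblemRegT3 n h′` carries `η = L^{−n}`. [cite: Balaban1985Variational, (2) p.278, (6)∕(8) pp.278–279] -/
theorem AlphaInputsT3AC.regOnT3_of_castLE {k n : ℕ} (hn : n ≤ k) (h : Hist (F.P K) k) (h' : Hist (F.P K) n)
    (hh' : ∀ j : Fin n, h' j = h (Fin.castLE hn j)) {e e' : ℝ} (he : e ≤ e') (U : GaugeField (F.P K) 0 (Matrix.specialUnitaryGroup (Fin 2) ℂ))
    (hU : AlphaInputsT3AC.RegOnT3 F 𝔠 γ hγ hγ1 K k h e U) : AlphaInputsT3AC.RegOnT3 F 𝔠 γ hγ hγ1 K n h' e' U := by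
  unfold AlphaInputsT3AC.RegOnT3 at hU ⊢
  have hL : (0 : ℝ) < (F.L : ℝ)⁻¹ := inv_pos.mpr (by exact_mod_cast (zero_lt_one.trans F.hL.2))
  exact inSpace_mono_levels_eta hn (fun j hj => Omega_eq_of_castLE _ _ h hn h' hh' j hj) he (pow_pos hL k) (pow_pos hL n) _ hU

/-- **(hreg) THE LEVEL-`n` REGULAR FIBRE OF `U`'s OWN `n`-DATUM**: a member of `regFibreRegT3 k h e 𝓥` lies, for `n ≤ k` and `e ≤ e′`, in
`regFibreRegT3 n h′ e′ (datumE av n Λ(h′) U)` — the transport's `U_k ∈ (6)_{n}` with NO scale-change constant ((6)_n has FEWER clauses than (8)_k; contrast [Balaban1985Variational]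
(13)–(14)'s `C₁ = L³` for the opposite passage). [cite: Balaban1985Variational, (6)∕(8) pp.278–279, (13)–(14) p.280] -/
theorem AlphaInputsT3AC.mem_regFibreRegT3_datumE_of_castLE {k n : ℕ} (hn : n ≤ k) (h : Hist (F.P K) k) (h' : Hist (F.P K) n)
    (hh' : ∀ j : Fin n, h' j = h (Fin.castLE hn j)) {e e' : ℝ} (he : e ≤ e')
    {𝓥 : (j : ℕ) → GaugeField (F.P K) j (Matrix.specialUnitaryGroup (Fin 2) ℂ)} {U : GaugeField (F.P K) 0 (Matrix.specialUnitaryGroup (Fin 2) ℂ)}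
    (hU : U ∈ AlphaInputsT3AC.regFibreRegT3 F 𝔠 γ hγ hγ1 K k h e 𝓥) :
    U ∈ AlphaInputsT3AC.regFibreRegT3 F 𝔠 γ hγ hγ1 K n h' e'
      (datumE (fun i => BlockAveraging.blockAvg (P := F.P K) (j := i) ℰp) n
        (lam42 (Omega 𝔠.lane.carrier.M₁ (rcolOf (T3Scales F γ hγ (hγ1.trans (sq_min_one_le _ 𝔠.gamma0_pos)) K) 𝔠.lane.carrier) n h') n) U) :=
  ⟨AlphaInputsT3AC.regOnT3_of_castLE hn h h' hh' he U hU.1, constraintOn_datumE_self U⟩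

/-- **(hcrit) READING R1 ⇒ READING R2**: a configuration on the minimal orbit at radius `e > 0` is critical in the carrier's sense (`∃ e > 0`, member + minimiser).
[cite: Balaban1985Variational, Thm 1 (8) p.279] -/
theorem AlphaInputsT3AC.isCritical_of_onMinimalOrbit {k : ℕ} (h : Hist (F.P K) k) {e : ℝ} (he : 0 < e)
    {𝓥 : (j : ℕ) → GaugeField (F.P K) j (Matrix.specialUnitaryGroup (Fin 2) ℂ)} {U : GaugeField (F.P K) 0 (Matrix.specialUnitaryGroup (Fin 2) ℂ)}
    (hU : (AlphaInputsT3AC.varProblemRegT3 F 𝔠 γ hγ hγ1 K k h).OnMinimalOrbit e 𝓥 U) :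
    (AlphaInputsT3AC.varProblemRegT3 F 𝔠 γ hγ hγ1 K k h).IsCritical 𝓥 U :=
  ⟨e, he, hU.1, hU.2⟩

/-- ★ **(N) [Balaban1985Variational] THEOREM 1 AT THE REGIONAL CARRIER ⇒ LQB's `LevelMin` PACKAGE ON NORMALISED DATA** (+ the R1 minimal-orbit clause and Thm 1's
uniqueness clause in the carrier's reading R2, passed through): for `0 < ε₁ ≤ a₁` there is a minimiser MAP `y ↦ U_k(y)` (one minimal configuration per normalised (7)-regular
multi-level datum, by choice over (8); arbitrary elsewhere) with `U_k(y) ∈ 𝔘_k(B₃ε₁)`, `datumE (U_k y) = y`, and `A(U_k y) ≤ A(x)` for every `x ∈ 𝔘_k(B₃ε₁)` with `datumE x = y`.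
LQB's ✓`levelMin_of_thm1At` is the same statement through a `B11Dict`; its clause `inB_iff` fails for un-normalised data, whence the cut `ofDataE y = y`
(✓`constraintOn_iff_datumE_eq`). [cite: Balaban1985Variational, Thm 1 p.279, (3) p.278; Balaban1985UV3, (42) p.266] -/
theorem AlphaInputsT3AC.levelMin_of_thm1At_regT3 (C : B11Thm1.Consts) {k : ℕ} (h : Hist (F.P K) k)
    (hT : B11Thm1.Thm1At C (AlphaInputsT3AC.varProblemRegT3 F 𝔠 γ hγ hγ1 K k h).toVarProblem) {ε₁ : ℝ} (hε₁ : 0 < ε₁) (hε₁a : ε₁ ≤ C.a₁) :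
    ∃ Uk : ((j : ℕ) → GaugeField (F.P K) j (Matrix.specialUnitaryGroup (Fin 2) ℂ)) → GaugeField (F.P K) 0 (Matrix.specialUnitaryGroup (Fin 2) ℂ),
      LevelMin (fun U : GaugeField (F.P K) 0 (Matrix.specialUnitaryGroup (Fin 2) ℂ) => wilsonAction4 U)
        (datumE (fun i => BlockAveraging.blockAvg (P := F.P K) (j := i) ℰp) k
          (lam42 (Omega 𝔠.lane.carrier.M₁ (rcolOf (T3Scales F γ hγ (hγ1.trans (sq_min_one_le _ 𝔠.gamma0_pos)) K) 𝔠.lane.carrier) k h) k))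
        (fun _ => {U | AlphaInputsT3AC.RegOnT3 F 𝔠 γ hγ hγ1 K k h (C.B₃ * ε₁) U})
        {y | ofDataE k (lam42 (Omega 𝔠.lane.carrier.M₁ (rcolOf (T3Scales F γ hγ (hγ1.trans (sq_min_one_le _ 𝔠.gamma0_pos)) K) 𝔠.lane.carrier) k h) k) y = y ∧
          (AlphaInputsT3AC.varProblemRegT3 F 𝔠 γ hγ hγ1 K k h).Reg7 ε₁ y} Uk ∧
      (∀ y, ofDataE k (lam42 (Omega 𝔠.lane.carrier.M₁ (rcolOf (T3Scales F γ hγ (hγ1.trans (sq_min_one_le _ 𝔠.gamma0_pos)) K) 𝔠.lane.carrier) k h) k) y = y →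
        (AlphaInputsT3AC.varProblemRegT3 F 𝔠 γ hγ hγ1 K k h).Reg7 ε₁ y →
          (AlphaInputsT3AC.varProblemRegT3 F 𝔠 γ hγ hγ1 K k h).OnMinimalOrbit (C.B₃ * ε₁) y (Uk y)) ∧
      ∀ ε₀ : ℝ, C.B₃ * ε₁ ≤ ε₀ → ε₀ ≤ C.a₀ → ∀ y,
        ofDataE k (lam42 (Omega 𝔠.lane.carrier.M₁ (rcolOf (T3Scales F γ hγ (hγ1.trans (sq_min_one_le _ 𝔠.gamma0_pos)) K) 𝔠.lane.carrier) k h) k) y = y →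
        (AlphaInputsT3AC.varProblemRegT3 F 𝔠 γ hγ hγ1 K k h).Reg7 ε₁ y →
          (AlphaInputsT3AC.varProblemRegT3 F 𝔠 γ hγ hγ1 K k h).UniqueCriticalOrbit ε₀ y (Uk y) := by
  classical
  set Pk := AlphaInputsT3AC.varProblemRegT3 F 𝔠 γ hγ hγ1 K k h with hPk
  have hne : Nonempty (GaugeField (F.P K) 0 (Matrix.specialUnitaryGroup (Fin 2) ℂ)) := ⟨fun _ => 1⟩
  -- Theorem 1 at the constants `C`, for the (7)-regular data: clause (8) gives the minimal configuration to choose, clause (6) its uniqueness reading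
  have H : ∀ y : Pk.Bdry, Pk.Reg7 ε₁ y →
      B11Thm1.Exists8 Pk.toVarProblem C.B₃ ε₁ y ∧ B11Thm1.Unique6 Pk.toVarProblem C.a₀ C.B₃ ε₁ y :=
    fun y hy => ⟨(hT ε₁ hε₁ hε₁a y hy).1, (hT ε₁ hε₁ hε₁a y hy).2.1⟩
  let Uk : Pk.Bdry → Pk.Cfg := fun y => if hy : Pk.Reg7 ε₁ y then Classical.choose (H y hy).1 else Classical.choice hne
  have hUk : ∀ y, ∀ hy : Pk.Reg7 ε₁ y, Uk y = Classical.choose (H y hy).1 := fun y hy => dif_pos hy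
  have hspec : ∀ y, Pk.Reg7 ε₁ y → Pk.InU (C.B₃ * ε₁) (Uk y) ∧ Pk.InB y (Uk y) ∧ Pk.OnMinimalOrbit (C.B₃ * ε₁) y (Uk y) := by
    intro y hy
    rw [hUk y hy]
    exact Classical.choose_spec (H y hy).1
  refine ⟨Uk, ⟨?_, ?_, ?_⟩, fun y _ hy => (hspec y hy).2.2, ?_⟩
  · intro y hy
    exact (hspec y hy.2).1
  · intro y hy
    exact (constraintOn_iff_datumE_eq hy.1).mp ((hspec y hy.2).2.1)
  · intro y hy x hx hxy
    have hmin := (hspec y hy.2).2.2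
    have hxB : Pk.InB y x := (constraintOn_iff_datumE_eq hy.1).mpr hxy
    exact hmin.2 ⟨hx, hxB⟩
  · intro ε₀ hlo hhi y _ hy
    exact (H y hy).2 ε₀ hlo hhi (Uk y) (hspec y hy).2.2

end T3

end Summit.QuantumFields.YangMills.Theorems

end
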